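import Summits.AtomisticToContinuum.Crystallization.Theses.ReggeStarCoercivity
import Summits.AtomisticToContinuum.Crystallization.Theorems.ReggeStarCoercivityDefectFreeCrystallizesExactStarShortcutFirstShell
import Summits.AtomisticToContinuum.Crystallization.Theorems.ReggeStarCoercivityDefectFreeCrystallizesExactStarShortcut
import Summits.AtomisticToContinuum.Crystallization.Theorems.ReggeStarCoercivityDefectFreeCrystallizesFunnelSitesDefs
import Summits.AtomisticToContinuum.Crystallization.Theorems.ReggeStarCoercivityDefectFreeCrystallizesRouteBetaRootDiscount
import Literature.MathematicalPhysics.StatisticalMechanics.BarlowStackingEnergy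
import Summits.AtomisticToContinuum.Crystallization.Theorems.ReggeStarCoercivityDefectFreeCrystallizesCoreOfGaugedFloor
import Summits.AtomisticToContinuum.Crystallization.Theorems.ReggeStarCoercivityDefectFreeCrystallizesStressEnergy
import Summits.AtomisticToContinuum.Crystallization.Theorems.ReggeStarCoercivityDefectFreeCrystallizesProcrustes

/-!
# Crux `ReggeStarCoercivity.DefectFreeCrystallizes` (item stmt-AtomisticToContinuum-13603) — CHECKED SKELETON, line `palm-good-law`,
# lead c11, v38 (v36 + glue LANDED p172904 + engine tool stubs; THIN FORM: every landed piece is referenced BY NAME; the inline history v10–v35 is in the tree history of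
# `Cruxes/DefectFreeCrystallizes/Lines/palm_good_law.lean` — v35 = commit of lead c10, 1 sorry — and in `Cruxes/…/NOTES.md`).

STATE (v37/v38).  In the tree the crux is closed modulo ONE statement of this line in EITHER of two registered formats:
* ε — GROUND-STATE FUNNEL EQUALITY, first-shell form `stub_funnelEquality` (law level; lead c10; glue-by
  `…ExactStarShortcutFirstShell.defectFreeCrystallizes_of_funnelEquality`, p168100);
* σ — POINTWISE GAUGED DEFECT FLOOR AT THE ROOT `stub_gaugedDefectFloorRoot` (S4″; strategist gen 3, line card `Lines/sos-cluster.md`: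
  the native output of a real-space cluster sum-of-squares certificate with a mass-transport gauge) through the glue
  `stub_coreOfGaugedFloor : S4″ → κ-CORE` (L; Mecke level pricing, pattern = landed `RouteBetaReshape` + `RouteBetaLawFree` +
  `LevelPricing` + `DefectVersion`) and the landed `…ExactStarShortcut.defectFreeCrystallizes_of_core` (p162359; crux 9226 not used).
v36 ADOPTED σ into the line (as v30 adopted the gen-2 exact-star shortcut); v37: the glue `stub_coreOfGaugedFloor` LANDED (wave 1,
`…Theorems.PalmGoodLaw.CoreOfGaugedFloor.stub_coreOfGaugedFloor`, p172904) ⇒ registered stubs = {`stub_funnelEquality` [residue ε, XL],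
`stub_gaugedDefectFloorRoot` [S4″ = residue σ, XL — the engine target]}; `DefectFreeCrystallizes_of` concludes the crux BY NAME from S4″ ALONE,
`DefectFreeCrystallizes_of_funnelEquality'` from FE alone.  v38 added ENGINE TOOL stubs (finite-dimensional pieces of the δs-variable
cluster certificate behind both formats): `stub_procrustes` LANDED p174098 (wave 2), `stub_stressEnergy` LANDED p173328 (lead).
Sorries = the two residue formats only.
-/

noncomputable section

open scoped BigOperators ENNReal
open Filter Topology MeasureTheory

namespace Summit.AtomisticToContinuum.Crystallization.Cruxes.DefectFreeCrystallizes.PalmGoodLaw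

open Summit.AtomisticToContinuum.Crystallization.Theses
open Literature.MathematicalPhysics.StatisticalMechanics Literature.Geometry.DiscreteGeometry
open Literature.Probability.Process
open Summit.AtomisticToContinuum.Crystallization.Theorems.PalmGoodLaw (SetGood)
open Summit.AtomisticToContinuum.Crystallization.Theorems.PalmGoodLaw (FunnelSites.IsCubicSite65)

/-! ## ε — the law-level residue (lead c10, v33/v35; registered) -/

/-- **`stub_funnelEquality` — GROUND-STATE FUNNEL EQUALITY, FIRST-SHELL FORM** (THE residue of crux 13603 at law level; XL,
certificate class).  For the relaxed reference `(a₀, h₀)` (box + global `hcpE`-minimality) and every hard core `δ > 0`: a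
point-stationary probability law on rooted `δ`-hard-core configurations, a.s. carried by everywhere-`SetGood` Barlow-charted
configurations (bond window `(0, 6/5)`) in force balance at every point, with zero mean virial stress and mean root energy at most
the periodic infimum `e*`, has a.s. an EXACT root star (congruence defect `0` against the relaxed-hcp star or the regular
cuboctahedron `a₀ • fccKissingPattern`) and no thirteenth atom inside the bond radius (`μ{11/10 < ‖y‖ < 6/5} = 0`).
Glue-by: `ExactStarShortcutFirstShell.defectFreeCrystallizes_of_funnelEquality` (p168100).  Sufficient entries: the κ-CORE
(`ExactStarShortcut.ae_exactRoot_of_core` + `…FirstShell.funnelEquality_of_funnelEqualityV32`), hence σ below. [folklore] -/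
theorem stub_funnelEquality :
    ∀ a₀ h₀ : ℝ, 189 / 200 ≤ a₀ → a₀ ≤ 199 / 200 → 77 / 100 ≤ h₀ → h₀ ≤ 163 / 200 →
      (∀ a h : ℝ, 0 < a → 0 < h →
        Summit.AtomisticToContinuum.Crystallization.Theorems.PalmUnimodularRigidity.LayeredLawsSelectHcp.hcpE a₀ h₀ ≤
          Summit.AtomisticToContinuum.Crystallization.Theorems.PalmUnimodularRigidity.LayeredLawsSelectHcp.hcpE a h) →
      ∀ δ : ℝ, 0 < δ → ∀ P : Measure (Measure (EuclideanSpace ℝ (Fin 3))), IsProbabilityMeasure P →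
        (∀ᵐ μ ∂P, IsRootedHardCore δ μ) → IsPointStationaryLaw P →
        (∀ᵐ μ ∂P, ∃ S : Set (EuclideanSpace ℝ (Fin 3)),
          μ = (Measure.count : Measure (EuclideanSpace ℝ (Fin 3))).restrict S ∧
          (∀ y ∈ S, SetGood S y) ∧
          ∃ s : ℤ → ℤ, IsHaggSeq s ∧
            ∃ Φ : EuclideanSpace ℝ (Fin 3) → EuclideanSpace ℝ (Fin 3),
              Set.BijOn Φ (barlowStacking 1 (Real.sqrt (2 / 3)) s) S ∧
              ∀ p ∈ barlowStacking 1 (Real.sqrt (2 / 3)) s, ∀ q ∈ barlowStacking 1 (Real.sqrt (2 / 3)) s,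
                (dist p q = 1 ↔ (0 < dist (Φ p) (Φ q) ∧ dist (Φ p) (Φ q) < 6 / 5))) →
        (∀ᵐ μ ∂P, ∃ S : Set (EuclideanSpace ℝ (Fin 3)),
          μ = (Measure.count : Measure (EuclideanSpace ℝ (Fin 3))).restrict S ∧
          ∀ p ∈ S, HasSum (fun q : {q : EuclideanSpace ℝ (Fin 3) // q ∈ S ∧ q ≠ p} =>
            (deriv lennardJones (dist p q.1) / dist p q.1) • (p - q.1)) 0) →
        (∀ M : EuclideanSpace ℝ (Fin 3) →L[ℝ] EuclideanSpace ℝ (Fin 3),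
          ∫ μ, (∫ y, deriv lennardJones ‖y‖ / ‖y‖ * inner ℝ y (M y) ∂μ) ∂P = 0) →
        (∫ μ, (∫ y, lennardJones ‖y‖ ∂μ) / 2 ∂P) ≤
          (⨅ Q : Literature.MathematicalPhysics.StatisticalMechanics.PeriodicConfiguration 3,
            Q.energyPerParticle Literature.MathematicalPhysics.StatisticalMechanics.lennardJones) →
        ∀ᵐ μ ∂P,
          (Summit.AtomisticToContinuum.Crystallization.Theorems.PalmUnimodularRigidity.LayeredLawsSelectHcp.starDefect a₀ h₀ μ = 0 ∨
            (⨅ A : EuclideanSpace ℝ (Fin 3) ≃ₗᵢ[ℝ] EuclideanSpace ℝ (Fin 3),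
              ∑ p ∈ fccKissingPattern, Metric.infDist (A (a₀ • p))
                (Summit.AtomisticToContinuum.Crystallization.Theorems.PalmUnimodularRigidity.LayeredLawsSelectHcp.rootStar μ) ^ 2) = 0) ∧
          μ {y : EuclideanSpace ℝ (Fin 3) | 11 / 10 < ‖y‖ ∧ ‖y‖ < 6 / 5} = 0 := by
  sorry

/-- **Composition ε (sorry-free modulo `stub_funnelEquality`): the crux BY NAME from the law-level residue alone** — through the
landed anchor `ExactStarShortcutFirstShell.defectFreeCrystallizes_of_funnelEquality` (p168100: X2B exact-star rigidity, X3 exact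
selection, `level_and_hcp_of_stack`, P1 good law, R3 charge, item 2916's charged-pattern crystallization). [folklore] -/
theorem DefectFreeCrystallizes_of_funnelEquality' :
    Summit.AtomisticToContinuum.Crystallization.Theses.ReggeStarCoercivity.DefectFreeCrystallizes :=
  Summit.AtomisticToContinuum.Crystallization.Theorems.PalmGoodLaw.ExactStarShortcutFirstShell.defectFreeCrystallizes_of_funnelEquality
    stub_funnelEquality

/-! ## σ — the pointwise engine format (strategist gen 3, line card `Lines/sos-cluster.md`; ADOPTED v36) -/

/-- **`stub_gaugedDefectFloorRoot` — S4″, POINTWISE GAUGED DEFECT FLOOR AT THE ROOT** (registered 2026-08-17 by strategist s3; XL — the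
target of the cluster sum-of-squares engine).  For the relaxed reference `(a₀, h₀)` and every hard-core radius `δ` there are a price
`κ > 0` and a per-fault discount `0 ≤ W ≤ J₃ − J₂` such that for every slack `ε > 0` a BOUNDED FINITE-RANGE jointly measurable bond
transfer `t` makes, on EVERY rooted `δ`-separated everywhere-`SetGood` Barlow-charted force-balanced configuration `μ = count|S` whose
root carries the chart label `(k, i, j)`:  `e_own(s, k) − ε − W·[root cubic] + κ·D(μ) ≤ h(μ) + div t(μ)`, with
`e_own = barlowSiteEnergy lennardJones a₀ h₀ s k`, `D` the κ-CORE's defect functional and `div t(μ) = ∫ (t μ y − t (θ_y μ) (−y)) dμ(y)`.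
Verbatim `SosCluster.GaugedDefectFloorRoot` of `Lines/sos_cluster.lean`.  Why it might fail: a genuine box-scale obstruction to exact
finite-range splitting at the nonlinear level (the harmonic splitting exists: kit j027085). [folklore] -/
theorem stub_gaugedDefectFloorRoot :
    ∀ a₀ h₀ : ℝ, 189 / 200 ≤ a₀ → a₀ ≤ 199 / 200 → 77 / 100 ≤ h₀ → h₀ ≤ 163 / 200 →
      (∀ a h : ℝ, 0 < a → 0 < h → Summit.AtomisticToContinuum.Crystallization.Theorems.PalmUnimodularRigidity.LayeredLawsSelectHcp.hcpE a₀ h₀ ≤ Summit.AtomisticToContinuum.Crystallization.Theorems.PalmUnimodularRigidity.LayeredLawsSelectHcp.hcpE a h) →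
      ∀ δ : ℝ, 0 < δ → ∃ κ : ℝ, 0 < κ ∧ ∃ W : ℝ, 0 ≤ W ∧
        W ≤ barlowCoupling lennardJones a₀ h₀ 3 - barlowCoupling lennardJones a₀ h₀ 2 ∧
        ∀ ε : ℝ, 0 < ε →
          ∃ R M : ℝ, ∃ t : Measure (EuclideanSpace ℝ (Fin 3)) → EuclideanSpace ℝ (Fin 3) → ℝ,
            (Measurable (Function.uncurry t) ∧ (∀ μ y, |t μ y| ≤ M) ∧ ∀ μ y, R < ‖y‖ → t μ y = 0) ∧
            ∀ (μ : Measure (EuclideanSpace ℝ (Fin 3))) (S : Set (EuclideanSpace ℝ (Fin 3))) (s : ℤ → ℤ)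
              (Φ : EuclideanSpace ℝ (Fin 3) → EuclideanSpace ℝ (Fin 3)),
              μ = (Measure.count : Measure (EuclideanSpace ℝ (Fin 3))).restrict S →
              (0 : EuclideanSpace ℝ (Fin 3)) ∈ S → (∀ x ∈ S, ∀ y ∈ S, x ≠ y → δ ≤ dist x y) →
              (∀ y ∈ S, SetGood S y) → IsHaggSeq s →
              Set.BijOn Φ (barlowStacking 1 (Real.sqrt (2 / 3)) s) S →
              (∀ p ∈ barlowStacking 1 (Real.sqrt (2 / 3)) s, ∀ q ∈ barlowStacking 1 (Real.sqrt (2 / 3)) s,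
                (dist p q = 1 ↔ (0 < dist (Φ p) (Φ q) ∧ dist (Φ p) (Φ q) < 6 / 5))) →
              (∀ p ∈ S, HasSum (fun q : {q : EuclideanSpace ℝ (Fin 3) // q ∈ S ∧ q ≠ p} =>
                (deriv lennardJones (dist p q.1) / dist p q.1) • (p - q.1)) 0) →
              ∀ k i j : ℤ, Φ (barlowPos 1 (Real.sqrt (2 / 3)) s k i j) = 0 →
                barlowSiteEnergy lennardJones a₀ h₀ s k - ε -
                      {S' : Set (EuclideanSpace ℝ (Fin 3)) | FunnelSites.IsCubicSite65 S' 0}.indicator (fun _ => W) S +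
                    κ * (min (Summit.AtomisticToContinuum.Crystallization.Theorems.PalmUnimodularRigidity.LayeredLawsSelectHcp.starDefect a₀ h₀ μ)
                            (⨅ A : EuclideanSpace ℝ (Fin 3) ≃ₗᵢ[ℝ] EuclideanSpace ℝ (Fin 3),
                              ∑ p ∈ fccKissingPattern, Metric.infDist (A (a₀ • p)) (Summit.AtomisticToContinuum.Crystallization.Theorems.PalmUnimodularRigidity.LayeredLawsSelectHcp.rootStar μ) ^ 2) +
                          (μ {y : EuclideanSpace ℝ (Fin 3) | 11 / 10 < ‖y‖ ∧ ‖y‖ ≤ 5 / 4}).toReal) ≤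
                  (∫ y, lennardJones ‖y‖ ∂μ) / 2 + ∫ y, (t μ y - t (Measure.map (fun z => z - y) μ) (-y)) ∂μ := by
  sorry

/-! ### `stub_coreOfGaugedFloor` — GLUE, LANDED (wave 1, p172904): `…Theorems.PalmGoodLaw.CoreOfGaugedFloor.stub_coreOfGaugedFloor : S4″ → κ-CORE`
(hypothesis of `ExactStarShortcut.defectFreeCrystallizes_of_core`, p162359, verbatim) — direct Mecke level pricing with the level function
`hcpE − ε + (J₃−J₂)/6·nC − (J₃−J₂+W)·1_{C0} + κ·(Dm μ).toReal` (`LevelPricing.stub_levelPricing`, covariant Mecke `E[nC] = 12·P(C0)`, the LJ column,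
item 3063's box from `tube_minimiserEnclosure`), then `ε ↓ 0`; used BY NAME in `DefectFreeCrystallizes_of` below. -/



/-! ## Engine tools (lead c11, v38): finite-dimensional pieces every δs-variable certificate for S4″ / the κ-CORE consumes -/

/-- **`stub_procrustes` — LOCAL QUANTITATIVE RIGIDITY OF A SPANNING POINT CONFIGURATION (tool stub; LANDED p174098 wave 2, `…Theorems.PalmGoodLaw.Procrustes.stub_procrustes`, C = 2(n+1)(1680μ²M + 48μn) + 1, ρ = 1/(80000(n+1)(μ²+1)), μ = M/m²).**
For `n` reference points `p i` of `ℝ³` whose frame is non-degenerate (`Σ_i ⟨p i, x⟩² ≥ m‖x‖²`) and bounded (`Σ_i ‖p i‖² ≤ M`) there are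
constants `C, ρ > 0` depending only on `(n, m, M)` such that every configuration `y` whose ROOTED GRAM DATA is `ρ`-close to the reference —
squared norms `‖y i‖²` and squared mutual distances `‖y i − y j‖²` — is, after a linear isometry `A` of `ℝ³`, close to the reference in
position: `Σ_i ‖A (p i) − y i‖² ≤ C · (Σ_i (‖y i‖² − ‖p i‖²)² + Σ_i Σ_j (‖y i − y j‖² − ‖p i − p j‖²)²)`.  This is the domination of the
κ-CORE's congruence defect `starDefect` (an `inf` over isometries of squared distances to the root star; `infDist ≤ dist` to the labelled
partner) by the squared-distance deviations `δs` in which cluster certificates are written (lead c11 NOTES "Engine analysis").  Proof sketch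
(elementary, no SVD): with `P = [p i]`, `P⁺ = Pᵀ(PPᵀ)⁻¹`, `L := Y P⁺`, the Gram deviation `ΔG = YᵀY − PᵀP` is linear in the data
(polarisation), `E := Y − LP` satisfies `E = (Lᵀ)⁻¹ (P⁺)ᵀ Π ΔG (I − Π)` exactly (`Π = P⁺P`, `EΠ = 0`), `LᵀL − I = (P⁺)ᵀ ΔG P⁺`, and
Gram–Schmidt of `L` gives an isometry `A` with `‖A − L‖ ≤ C‖LᵀL − I‖` once `‖ΔG‖ ≤ ρ`. [folklore] -/
theorem stub_procrustes :
    ∀ (n : ℕ) (m M : ℝ), 0 < m → 0 ≤ M → ∃ C ρ : ℝ, 0 < C ∧ 0 < ρ ∧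
      ∀ p : Fin n → EuclideanSpace ℝ (Fin 3),
        (∀ x : EuclideanSpace ℝ (Fin 3), m * ‖x‖ ^ 2 ≤ ∑ i, inner ℝ (p i) x ^ 2) →
        (∑ i, ‖p i‖ ^ 2 ≤ M) →
        ∀ y : Fin n → EuclideanSpace ℝ (Fin 3),
          (∑ i, (‖y i‖ ^ 2 - ‖p i‖ ^ 2) ^ 2 + ∑ i, ∑ j, (‖y i - y j‖ ^ 2 - ‖p i - p j‖ ^ 2) ^ 2 ≤ ρ) →
          ∃ A : EuclideanSpace ℝ (Fin 3) ≃ₗᵢ[ℝ] EuclideanSpace ℝ (Fin 3),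
            ∑ i, ‖A (p i) - y i‖ ^ 2 ≤
              C * (∑ i, (‖y i‖ ^ 2 - ‖p i‖ ^ 2) ^ 2 + ∑ i, ∑ j, (‖y i - y j‖ ^ 2 - ‖p i - p j‖ ^ 2) ^ 2) :=
  Summit.AtomisticToContinuum.Crystallization.Theorems.PalmGoodLaw.Procrustes.stub_procrustes

/-- **`stub_stressEnergy` — CONNELLY'S STRESS–ENERGY IDENTITY (tool stub; LANDED p173328, `…Theorems.PalmGoodLaw.StressEnergy.stub_stressEnergy`).**  For a symmetric weight `β` on the pairs
of a finite point configuration `p` that is an EQUILIBRIUM STRESS (`Σ_j β i j • (p i − p j) = 0` at every point `i`), the `β`-weighted sum of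
the EXACT squared-distance deviations under an arbitrary finite displacement `u` equals the `β`-weighted sum of the squared relative
displacements: `Σ_{i,j} β i j (‖(p i + u i) − (p j + u j)‖² − ‖p i − p j‖²) = Σ_{i,j} β i j ‖u i − u j‖²` — the linear term
`2⟨p i − p j, u i − u j⟩` sums to zero against an equilibrium stress.  This is what makes a cluster certificate written in squared-distance
deviations with SELF-STRESS first order (`q_T = Σ β δs + Σ Γ δs δs`, lead c11 NOTES "Engine analysis") free of any linear part, pointwise and
without a gauge: its "first-order" share is exactly the quadratic prestress form. [cite: Connelly 1982, Invent. Math. 66, "Rigidity and energy", §2] -/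
theorem stub_stressEnergy :
    ∀ (n : ℕ) (β : Fin n → Fin n → ℝ) (p u : Fin n → EuclideanSpace ℝ (Fin 3)),
      (∀ i j, β i j = β j i) → (∀ i, ∑ j, β i j • (p i - p j) = 0) →
      ∑ i, ∑ j, β i j * (‖(p i + u i) - (p j + u j)‖ ^ 2 - ‖p i - p j‖ ^ 2) = ∑ i, ∑ j, β i j * ‖u i - u j‖ ^ 2 :=
  Summit.AtomisticToContinuum.Crystallization.Theorems.PalmGoodLaw.StressEnergy.stub_stressEnergy

/-- **Composition σ (sorry-free modulo `stub_gaugedDefectFloorRoot`): the crux BY NAME from the pointwise engine target S4″ ALONE** (glue landed p172904),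
through the landed exact-star shortcut `ExactStarShortcut.defectFreeCrystallizes_of_core` (p162359; crux 9226 not used). [folklore] -/
theorem DefectFreeCrystallizes_of :
    Summit.AtomisticToContinuum.Crystallization.Theses.ReggeStarCoercivity.DefectFreeCrystallizes :=
  Summit.AtomisticToContinuum.Crystallization.Theorems.PalmGoodLaw.ExactStarShortcut.defectFreeCrystallizes_of_core
    (Summit.AtomisticToContinuum.Crystallization.Theorems.PalmGoodLaw.CoreOfGaugedFloor.stub_coreOfGaugedFloor
      stub_gaugedDefectFloorRoot)

end Summit.AtomisticToContinuum.Crystallization.Cruxes.DefectFreeCrystallizes.PalmGoodLaw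

end
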